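import Literature.Computability.QuantumComplexity.OracleSimReplayFP
import Literature.Computability.QuantumComplexity.CWrapPost
import HarnessLib

/-!
# Uniform oracle coin simulation, I: the block function

Topic `Literature/Computability/QuantumComplexity`; first file of a discharge of the named fact
`uniformOracleCoinSimulation` (`CoinFamilyKernel.lean`: the polynomial-time uniform reversible
simulation, *with oracle gates*, of a polynomial-time oracle algorithm run on `⟨x, coins⟩` —
Bernstein–Vazirani 1997, proof of Thm. 8.3 relativised as in their §8.3), built on the replay
bookkeeping `OSim.*` of `OracleSimReplay.lean` / `OracleSimReplayFP.lean` and the classical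
semantics of programs with queries of `OracleClassicalProgs.lean`.

The simulating circuit at input length `n` carries the input `x` (`n` wires), the coins `y`
(`q(n)` wires) and a register of *answer slots* `ans` as the data wires of ONE garbage-free block
(`RevClean.cleanOps`, constant suffix `CWrap.vg n` behind the data, as for the post-processor of
`CWrapLayout.lean`). The block computes the string function of this file,

  `simFn M r q (d ++ vg n) = OSim.replayFn M r ⟨⟨d ↾ n, (d ↓ n) ↾ q(n)⟩, d ↓ (n + q(n))⟩`,

i.e. it recovers `n` from the suffix (read backwards the content is the pairing `⟨1ⁿ, dʳ⟩`,
`CWrap.reverse_append_vg`), cuts `x`, `y`, `ans` out of the data and replays the oracle algorithm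
`M` on `⟨x, y⟩` against the slots (`OSim.replayFn_apply`: the `R = r(|⟨x, y⟩|)` padded queries
followed by the output). Main results: `simFn_apply` and `simFn_mem_FP` (brick algebra:
`CWrap.nUF`, `CWrap.dF`, `Plumb.takeFn/dropFn/polyFn`, `OSim.replayFn_mem_FP`).

## References

* E. Bernstein, U. Vazirani, *Quantum complexity theory*, SIAM J. Comput. 26 (1997) 1411–1473,
  Thm. 8.3 (proof, p. 1451: "a polynomial time deterministic TM" run on `⟨x, coins⟩` inside the
  quantum machine) and §8.3 (p. 1455, oracle QTMs) [BernsteinVazirani1997SICOMP].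
* S. Arora, B. Barak, *Computational Complexity: A Modern Approach*, CUP 2009, §1.3 (closure of
  polynomial time under composition) [AroraBarak2009].
-/

noncomputable section

namespace Literature.Computability.QuantumComplexity

namespace OCoin

open _root_.Computability Polynomial Complexity Complexity.Brick Complexity.Plumb

variable (M : OracleAlg (List Bool)) (r q : Polynomial ℕ)

/-! ### The block function -/

/-- The coins `y = (d ↓ n) ↾ q(n)` cut out of the data (`n` read off the suffix). [folklore] -/
def yF : List Bool → List Bool := takeFn ∘ fanoutFn (polyFn q ∘ CWrap.nUF) (dropFn ∘ fanoutFn CWrap.nUF CWrap.dF)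

/-- The slots `ans = d ↓ (n + q(n))`. [folklore] -/
def ansF : List Bool → List Bool := dropFn ∘ fanoutFn (polyFn q ∘ CWrap.nUF) (dropFn ∘ fanoutFn CWrap.nUF CWrap.dF)

/-- The argument `⟨⟨x, y⟩, ans⟩` of the replay. [folklore] -/
def argF : List Bool → List Bool := fanoutFn (fanoutFn CWrap.xF (yF q)) (ansF q)

/-- **The block function of the simulation**: parse `x`, `y`, `ans` out of the block content and
replay `M` on `⟨x, y⟩` against the slots. [cite: BernsteinVazirani1997SICOMP, Thm. 8.3 (proof) with §8.3] -/
def simFn : List Bool → List Bool := OSim.replayFn M r ∘ argF q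

variable {M r q}

/-- `CWrap.nUF` on a block content: `1ⁿ`. [folklore] -/
theorem nUF_append_vg (d : List Bool) (n : ℕ) : CWrap.nUF (d ++ CWrap.vg n) = List.replicate n true := by
  rw [CWrap.nUF_apply, CWrap.reverse_append_vg, boolUnpair_boolPair]

/-- `CWrap.dF` on a block content: the data. [folklore] -/
theorem dF_append_vg (d : List Bool) (n : ℕ) : CWrap.dF (d ++ CWrap.vg n) = d := by
  rw [CWrap.dF_apply, CWrap.reverse_append_vg, boolUnpair_boolPair, List.reverse_reverse]

/-- **The argument brick on a block content** `x y ans ++ vg n` (`|x| = n`, `|y| = q(n)`).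
[folklore] -/
theorem argF_apply {n : ℕ} (x y ans : List Bool) (hx : x.length = n) (hy : y.length = q.eval n) :
    argF q ((x ++ y ++ ans) ++ CWrap.vg n) = boolPair (boolPair x y) ans := by
  subst hx
  have h1 : (x ++ y ++ ans).take x.length = x := by
    rw [List.append_assoc, List.take_left]
  have h2 : ((x ++ y ++ ans).drop x.length).take (q.eval x.length) = y := by
    rw [List.append_assoc, List.drop_left, ← hy, List.take_left]
  have h3 : ((x ++ y ++ ans).drop x.length).drop (q.eval x.length) = ans := by
    rw [List.append_assoc, List.drop_left, ← hy, List.drop_left]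
  simp only [argF, yF, ansF, CWrap.xF, fanoutFn_apply, Function.comp_apply, nUF_append_vg, dF_append_vg,
    takeFn_boolPair, dropFn_boolPair, polyFn_apply, List.length_replicate, h1, h2, h3]

/-- **The block function on a block content**: the replay of `M` on `⟨x, y⟩` against `ans`.
[cite: BernsteinVazirani1997SICOMP, Thm. 8.3 (proof) with §8.3] -/
theorem simFn_apply {n : ℕ} (x y ans : List Bool) (hx : x.length = n) (hy : y.length = q.eval n) :
    simFn M r q ((x ++ y ++ ans) ++ CWrap.vg n) = OSim.replayFn M r (boolPair (boolPair x y) ans) := by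
  rw [simFn, Function.comp_apply, argF_apply x y ans hx hy]

/-- **The block function computes the block's word**: with `R(R+1)` slots, `R = r(|⟨x, y⟩|)`, the
value is `OSim.wordσ` — the `R` padded queries of the replay against the slots, then its output.
[cite: BernsteinVazirani1997SICOMP, Thm. 8.3 (proof) with §8.3] -/
theorem simFn_eq_wordσ {n : ℕ} (x y ans : List Bool) (hx : x.length = n) (hy : y.length = q.eval n)
    (hans : r.eval (boolPair x y).length * (r.eval (boolPair x y).length + 1) ≤ ans.length) :
    simFn M r q ((x ++ y ++ ans) ++ CWrap.vg n) =
      OSim.wordσ M (boolPair x y) (OSim.slotσ ans (r.eval (boolPair x y).length)) (r.eval (boolPair x y).length)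
        (r.eval (boolPair x y).length) := by
  rw [simFn_apply x y ans hx hy, OSim.replayFn_apply (OSim.le_length_boolPair_of_slots (r := r) _ _ hans)]

/-! ### Polynomial time -/

/-- `yF ∈ FP`. [folklore] -/
theorem yF_mem_FP : yF q ∈ FP :=
  comp_mem_FP takeFn_mem_FP (fanoutFn_mem_FP (comp_mem_FP (polyFn_mem_FP q) CWrap.nUF_mem_FP)
    (comp_mem_FP dropFn_mem_FP (fanoutFn_mem_FP CWrap.nUF_mem_FP CWrap.dF_mem_FP)))

/-- `ansF ∈ FP`. [folklore] -/
theorem ansF_mem_FP : ansF q ∈ FP :=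
  comp_mem_FP dropFn_mem_FP (fanoutFn_mem_FP (comp_mem_FP (polyFn_mem_FP q) CWrap.nUF_mem_FP)
    (comp_mem_FP dropFn_mem_FP (fanoutFn_mem_FP CWrap.nUF_mem_FP CWrap.dF_mem_FP)))

/-- `argF ∈ FP`. [folklore] -/
theorem argF_mem_FP : argF q ∈ FP :=
  fanoutFn_mem_FP (fanoutFn_mem_FP (comp_mem_FP takeFn_mem_FP (fanoutFn_mem_FP CWrap.nUF_mem_FP CWrap.dF_mem_FP))
    (yF_mem_FP)) ansF_mem_FP

/-- **The block function is polynomial time** (for a polynomial-time step function).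
[cite: AroraBarak2009, §1.3 (composition)] -/
theorem simFn_mem_FP (hM : M.IsPolyTime (encodingList Bool)) : simFn M r q ∈ FP :=
  comp_mem_FP (OSim.replayFn_mem_FP r hM) argF_mem_FP

end OCoin

end Literature.Computability.QuantumComplexity

end
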